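import Mathlib
import HarnessLib
import Summits.HubbardSuperconductivity.HubbardSuperconductivity.Theorems.KLProgrammeKLRegimeEnginePairTransferMemberDefectDiff

/-!
# Route `KLProgramme` — ENGINE child gen 8 (stmt-HubbardSuperconductivity-20437 `KLRegimeEngineV17F2`), skeleton v2 class #5 rev 3: THE ξΔ DOOR — the difference of two
# members' pinned Riccati defects bounded by nine `D`-carrying ROWS — **`klmd_defectDiff_le_rows`**
# (cell gate-hubbard-kl, seat hubbard-kl-k3c1-p1 g13, technique «composed-map remainder propagation»; norm form of `klmd_pinnedDefect_sub_eq`)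

WHY.  The hypothesis `‖((Ȧ_j + A_j·diag ḃ_j·A_j) − (Ȧ_{j′} + A_{j′}·diag ḃ_{j′}·A_{j′}))(t)(x,y)‖ ≤ ξΔ` of rows 29/30 (KLTC-INDEX v9.1) is, after the EXACT identity
`klmd_pinnedDefect_sub_eq`, one triangle inequality away from nine analytic ROWS, each the bound of ONE explicit finite sum carrying the symbol difference
`D = ψ₁ − ψ₂` (for the family pair: the deep complementary shell `s_{j′,j}`, index mass `klIdxMass n j′`): `Rhd` (the «≥ 2 cross lines» class difference),
`Rd₁ Rx₁ R6₁` (ph-direct at transfer `x − y` / ph-crossed at `x + y − Qm` / 6–2 at born overlap, with the `D`-WEIGHT against the slice line — the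
`min(|k−k′|/Λ, Λ/|k−k′|)`, `min(|k+k′−Qm|/Λ, …)` and overlap slots of `transferBarRelIdx_succ_room`'s ROOM), `Rd₂ Rx₂ R6₂` (member-2 weights against the DIFFERENCE of
the two carriers' kernels, `(e^{Δ_{S_D}} − 1)`-type), `Rl₁` (the `D`-rung rate `B(ẇ,D)`-type against member-1's localisation kernel = pinned-minus-resolved products),
`Rl₂` (member-2's rate against the difference of the localisation kernels).  THEN
`‖(S₁ − S₂)(t)(x,y)‖ ≤ (Λₙ − Λ_{n+1})·(½·Rhd + (βL²)⁻³·(Rd₁ + Rd₂ + Rx₁ + Rx₂ + 2(R6₁ + R6₂))) + Rl₁ + Rl₂` for ALL `x y` (off the ball the left side vanishes).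
This replaces, for the ξΔ row, the triangle route `klmf_defect_sub_le` of KLTC v8 §B (located «(ξΔ)-TRIANGLE»: its `m²·Σ‖ḃ_j − ḃ_{j′}‖` term has no `2⁻ⁿ` gain).
One triangle inequality over `klmd_pinnedDefect_sub_eq` + `klmd_norm_classes_le`; the SIZE of every row stays the analytic lanes'; nothing asserts (X).3, (c), K3 or
superconductivity.  0 kit · 0 lit.
-/

noncomputable section

namespace Summit.HubbardSuperconductivity.HubbardSuperconductivity.Theorems.KLRegimeSplit

set_option linter.dupNamespace false -- summit = problem name (single-conjunct summit), D-0017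

open Finset Matrix Set Literature.MathematicalPhysics.QuantumLattice Literature.Probability.LatticeModels GrassmannAlgebra
open Summit.HubbardSuperconductivity.HubbardSuperconductivity.Theorems.KLProgrammeLegKernels
open Summit.HubbardSuperconductivity.HubbardSuperconductivity.Theorems.TwoPointAssembly
open Summit.HubbardSuperconductivity.HubbardSuperconductivity.Theorems.DispersionFlow
open Summit.HubbardSuperconductivity.HubbardSuperconductivity.Theorems.KLRegimeWick

variable (L M : ℕ) [NeZero L] [NeZero M] (β U μ : ℝ) (K : TrigPolyC4v)

/-! ## §1 One member: off-ball vanishing and the ξᵢ door -/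

/-- Pure normed-field bookkeeping for the one-member door. -/
theorem klmd_norm_member_le {cΛ c3 H P Q S Lc : ℂ} {a b RH RP RQ RS RL : ℝ} (ha : ‖cΛ‖ = a) (hb : ‖c3‖ = b) (hH : ‖H‖ ≤ RH) (hP : ‖P‖ ≤ RP)
    (hQ : ‖Q‖ ≤ RQ) (hS : ‖S‖ ≤ RS) (hL : ‖Lc‖ ≤ RL) :
    ‖cΛ * (-((2 : ℂ)⁻¹ * H) - c3 * (P - Q - 2 * S)) + Lc‖ ≤ a * (2⁻¹ * RH + b * (RP + RQ + 2 * RS)) + RL := by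
  have h0a : 0 ≤ a := ha ▸ norm_nonneg _
  have h0b : 0 ≤ b := hb ▸ norm_nonneg _
  have h1 : ‖P - Q - 2 * S‖ ≤ RP + RQ + 2 * RS := by
    have h2 : ‖(2 : ℂ) * S‖ ≤ 2 * RS := by
      rw [norm_mul, Complex.norm_ofNat]; exact mul_le_mul_of_nonneg_left hS (by norm_num)
    have h3 := norm_sub_le (P - Q) (2 * S)
    have h4 := norm_sub_le P Q
    linarith
  have h2 : ‖-((2 : ℂ)⁻¹ * H) - c3 * (P - Q - 2 * S)‖ ≤ 2⁻¹ * RH + b * (RP + RQ + 2 * RS) := by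
    refine (norm_sub_le _ _).trans (add_le_add ?_ ?_)
    · rw [norm_neg, norm_mul, norm_inv, Complex.norm_ofNat]; exact mul_le_mul_of_nonneg_left hH (by norm_num)
    · rw [norm_mul, hb]; exact mul_le_mul_of_nonneg_left h1 h0b
  calc ‖cΛ * (-((2 : ℂ)⁻¹ * H) - c3 * (P - Q - 2 * S)) + Lc‖ ≤ ‖cΛ * (-((2 : ℂ)⁻¹ * H) - c3 * (P - Q - 2 * S))‖ + ‖Lc‖ := norm_add_le _ _
    _ ≤ a * (2⁻¹ * RH + b * (RP + RQ + 2 * RS)) + RL := by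
        refine add_le_add ?_ hL
        rw [norm_mul, ha]; exact mul_le_mul_of_nonneg_left h2 h0a

set_option maxHeartbeats 1600000 in -- the instantiated identity `klmd_pinnedDefect_eq_resolved`; plumbing only
/-- **Off the ball the pinned defect vanishes** (one member; binders of `klmd_pinnedDefect_eq_resolved` with `0 < β`). -/
theorem klmd_pinnedDefect_eq_zero_off (hβ : 0 < β) (n : ℕ) {ψ : FreqMomentum L M → ℝ} (hψ : ∀ k : FreqMomentum L M, ψ (k.1.rev, k.2) = ψ k)
    (Qm : TorusSite 2 L) (A A' : ℝ → Matrix (TorusSite 2 L) (TorusSite 2 L) ℂ) (b' : ℝ → TorusSite 2 L → ℂ)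
    (hAdef : A = fun t => Matrix.of fun k k' : TorusSite 2 L => if k ∈ klBall L μ 0 ∧ k' ∈ klBall L μ 0 then
      vertexFn L M β (gaussConv ℂ (softCovOf L M β μ K ψ + hubbardCovAboveCT L M β μ 0 K (klScale klE0 (n + 1)) - hubbardCovAboveCT L M β μ 0 K (klScale klE0 n + t * (klScale klE0 (n +
              1) - klScale klE0 n))) (hubbardEffectiveActionCT L M β U μ 0 K (klScale klE0 n + t * (klScale klE0 (n + 1) - klScale klE0 n)))) 4 ![(((omega0 M, k'), 0), 0), ((((omega0
              M).rev, Qm - k'), 1), 0), ((((omega0 M).rev, Qm - k), 1), 1), (((omega0 M, k), 0), 1)]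
      else 0)
    (hA'def : A' = fun t => Matrix.of fun k k' : TorusSite 2 L => if k ∈ klBall L μ 0 ∧ k' ∈ klBall L μ 0 then
      (klScale klE0 (n + 1) - klScale klE0 n) • -((2 : ℂ)⁻¹ * vertexFn L M β (gaussConv ℂ (softCovOf L M β μ K ψ + hubbardCovAboveCT L M β μ 0 K (klScale klE0 (n + 1)) -
              hubbardCovAboveCT L M β μ 0 K (klScale klE0 n + t * (klScale klE0 (n + 1) - klScale klE0 n))) (grassmannDerivPairing ℂ (Matrix.of fun X Y : HubbardFieldIdx L M => deriv
              (fun Λ'' : ℝ => hubbardCovAboveCT L M β μ 0 K Λ'' X Y) (klScale klE0 n + t * (klScale klE0 (n + 1) - klScale klE0 n))) (hubbardEffectiveActionCT L M β U μ 0 K (klScale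
              klE0 n + t * (klScale klE0 (n + 1) - klScale klE0 n))) (hubbardEffectiveActionCT L M β U μ 0 K (klScale klE0 n + t * (klScale klE0 (n + 1) - klScale klE0 n))))) 4
              ![(((omega0 M, k'), 0), 0), ((((omega0 M).rev, Qm - k'), 1), 0), ((((omega0 M).rev, Qm - k), 1), 1), (((omega0 M, k), 0), 1)])
      else 0)
    (hb'def : b' = fun (t : ℝ) (p : TorusSite 2 L) => (((klScale klE0 (n + 1) - klScale klE0 n) *
        (klBubbleMass L M β μ K (fun k => deriv (fun Λ' => hubbardCutoffWeightCT L M β μ K Λ' k) (klScale klE0 n + t * (klScale klE0 (n + 1) - klScale klE0 n))) (fun k => ψ k +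
                (hubbardCutoffWeightCT L M β μ K (klScale klE0 (n + 1)) k - hubbardCutoffWeightCT L M β μ K (klScale klE0 n + t * (klScale klE0 (n + 1) - klScale klE0 n)) k)) Qm p +
          klBubbleMass L M β μ K (fun k => ψ k + (hubbardCutoffWeightCT L M β μ K (klScale klE0 (n + 1)) k - hubbardCutoffWeightCT L M β μ K (klScale klE0 n + t * (klScale klE0 (n + 1)
                  - klScale klE0 n)) k)) (fun k => deriv (fun Λ' => hubbardCutoffWeightCT L M β μ K Λ' k) (klScale klE0 n + t * (klScale klE0 (n + 1) - klScale klE0 n))) Qm p) : ℝ) :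
                  ℂ))
    (V : ℝ → (Fin 4 → HubbardFieldIdx L M) → ℂ) (hV : V = fun t X => vertexFn L M β (gaussConv ℂ (softCovOf L M β μ K ψ + hubbardCovAboveCT L M β μ 0 K (klScale klE0 (n + 1)) -
            hubbardCovAboveCT L M β μ 0 K (klScale klE0 n + t * (klScale klE0 (n + 1) - klScale klE0 n))) (hubbardEffectiveActionCT L M β U μ 0 K (klScale klE0 n + t * (klScale klE0 (n
            + 1) - klScale klE0 n)))) 4 X)
    (V6 : ℝ → (Fin 6 → HubbardFieldIdx L M) → ℂ) (hV6 : V6 = fun t X => vertexFn L M β (gaussConv ℂ (softCovOf L M β μ K ψ + hubbardCovAboveCT L M β μ 0 K (klScale klE0 (n + 1)) -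
            hubbardCovAboveCT L M β μ 0 K (klScale klE0 n + t * (klScale klE0 (n + 1) - klScale klE0 n))) (hubbardEffectiveActionCT L M β U μ 0 K (klScale klE0 n + t * (klScale klE0 (n
            + 1) - klScale klE0 n)))) 6 X)
    (Sg : ℝ → FreqMomentum L M → Fin 2 → ℂ) (hSg : Sg = fun t p σ => selfEnergy L M β (gaussConv ℂ (softCovOf L M β μ K ψ + hubbardCovAboveCT L M β μ 0 K (klScale klE0 (n + 1)) -
            hubbardCovAboveCT L M β μ 0 K (klScale klE0 n + t * (klScale klE0 (n + 1) - klScale klE0 n))) (hubbardEffectiveActionCT L M β U μ 0 K (klScale klE0 n + t * (klScale klE0 (n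
            + 1) - klScale klE0 n)))) p σ)
    (Hd : ℝ → (Fin 4 → HubbardFieldIdx L M) → ℂ) (hHd : Hd = fun t X => vertexFn L M β (dblFold ℂ (grassmannLaplacian ℂ (crossCov ℂ (Matrix.of fun X Y : HubbardFieldIdx L M => deriv
            (fun Λ' : ℝ => hubbardCovAboveCT L M β μ 0 K Λ' X Y) (klScale klE0 n + t * (klScale klE0 (n + 1) - klScale klE0 n)))) ((gaussConv ℂ (crossCov ℂ (softCovOf L M β μ K ψ +
            hubbardCovAboveCT L M β μ 0 K (klScale klE0 (n + 1)) - hubbardCovAboveCT L M β μ 0 K (klScale klE0 n + t * (klScale klE0 (n + 1) - klScale klE0 n)))) - grassmannLaplacian ℂ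
            (crossCov ℂ (softCovOf L M β μ K ψ + hubbardCovAboveCT L M β μ 0 K (klScale klE0 (n + 1)) - hubbardCovAboveCT L M β μ 0 K (klScale klE0 n + t * (klScale klE0 (n + 1) -
            klScale klE0 n))))) (dblCopy ℂ 0 (gaussConv ℂ (softCovOf L M β μ K ψ + hubbardCovAboveCT L M β μ 0 K (klScale klE0 (n + 1)) - hubbardCovAboveCT L M β μ 0 K (klScale klE0 n
            + t * (klScale klE0 (n + 1) - klScale klE0 n))) (hubbardEffectiveActionCT L M β U μ 0 K (klScale klE0 n + t * (klScale klE0 (n + 1) - klScale klE0 n)))) * dblCopy ℂ 1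
            (gaussConv ℂ (softCovOf L M β μ K ψ + hubbardCovAboveCT L M β μ 0 K (klScale klE0 (n + 1)) - hubbardCovAboveCT L M β μ 0 K (klScale klE0 n + t * (klScale klE0 (n + 1) -
            klScale klE0 n))) (hubbardEffectiveActionCT L M β U μ 0 K (klScale klE0 n + t * (klScale klE0 (n + 1) - klScale klE0 n)))))))) 4 X)
    (Φ : ℝ → FreqMomentum L M → ℝ) (hΦ : Φ = fun t k => ψ k + (hubbardCutoffWeightCT L M β μ K (klScale klE0 (n + 1)) k - hubbardCutoffWeightCT L M β μ K (klScale klE0 n + t * (klScale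
            klE0 (n + 1) - klScale klE0 n)) k))
    (Wd : ℝ → FreqMomentum L M → ℝ) (hWd : Wd = fun t k => deriv (fun Λ' : ℝ => hubbardCutoffWeightCT L M β μ K Λ' k) (klScale klE0 n + t * (klScale klE0 (n + 1) - klScale klE0 n)))
    (Br : ℝ → TorusSite 2 L × MatsubaraIdx M → ℂ) (hBr : Br = fun t z => -(((((β * (L : ℝ) ^ 2 : ℝ) : ℂ)))⁻¹ * propCT L M β μ K (z.2, z.1) * propCT L M β μ K (z.2.rev, Qm - z.1)) *
      ((((klScale klE0 (n + 1) - klScale klE0 n) * (-Wd t (z.2, z.1) * Φ t (z.2.rev, Qm - z.1) - Φ t (z.2, z.1) * Wd t (z.2.rev, Qm - z.1))) : ℝ) : ℂ))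
    {t : ℝ} (ht : t ∈ Icc (0 : ℝ) 1) (x y : TorusSite 2 L)
    (hxy : ¬(x ∈ klBall L μ 0 ∧ y ∈ klBall L μ 0)) :
    (A' t + A t * diagonal (b' t) * A t) x y = 0 := by
  rw [klmd_pinnedDefect_eq_resolved L M β U μ K hβ.ne' n hψ Qm A A' b' hAdef hA'def hb'def V hV V6 hV6 Sg hSg Hd hHd Φ hΦ Wd hWd Br hBr ht x y, if_neg hxy]

set_option maxHeartbeats 1600000 in -- the instantiated identity `klmd_pinnedDefect_eq_resolved`; plumbing only
/-- **`klmd_defect_le_rows`** — THE ξᵢ DOOR (one member; rows 24/29/30 hypotheses `hS₁ hS₂`): binders of `klmd_pinnedDefect_eq_resolved` with `0 < β`, then FIVE rows at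
`(t,x,y)` — `RH ≥ ‖Hd t X̂‖` (≥ 2 cross lines), `RP ≥ ‖PHd‖` (slice line `ẇ` × running symbol `Φ` at transfer `x − y`), `RQ ≥ ‖PHx‖` (transfer `x + y − Qm`),
`RS ≥ ‖S62‖` (born overlap), `RL ≥ ‖LOC‖` (frequency localisation) — THEN `‖(Ȧ + A·diag ḃ·A)(t)(x,y)‖ ≤ (Λₙ − Λ_{n+1})·(½RH + (βL²)⁻³(RP + RQ + 2RS)) + RL` (all `x y`). -/
theorem klmd_defect_le_rows (hβ : 0 < β) (n : ℕ) {ψ : FreqMomentum L M → ℝ} (hψ : ∀ k : FreqMomentum L M, ψ (k.1.rev, k.2) = ψ k)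
    (Qm : TorusSite 2 L) (A A' : ℝ → Matrix (TorusSite 2 L) (TorusSite 2 L) ℂ) (b' : ℝ → TorusSite 2 L → ℂ)
    (hAdef : A = fun t => Matrix.of fun k k' : TorusSite 2 L => if k ∈ klBall L μ 0 ∧ k' ∈ klBall L μ 0 then
      vertexFn L M β (gaussConv ℂ (softCovOf L M β μ K ψ + hubbardCovAboveCT L M β μ 0 K (klScale klE0 (n + 1)) - hubbardCovAboveCT L M β μ 0 K (klScale klE0 n + t * (klScale klE0 (n +
              1) - klScale klE0 n))) (hubbardEffectiveActionCT L M β U μ 0 K (klScale klE0 n + t * (klScale klE0 (n + 1) - klScale klE0 n)))) 4 ![(((omega0 M, k'), 0), 0), ((((omega0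
              M).rev, Qm - k'), 1), 0), ((((omega0 M).rev, Qm - k), 1), 1), (((omega0 M, k), 0), 1)]
      else 0)
    (hA'def : A' = fun t => Matrix.of fun k k' : TorusSite 2 L => if k ∈ klBall L μ 0 ∧ k' ∈ klBall L μ 0 then
      (klScale klE0 (n + 1) - klScale klE0 n) • -((2 : ℂ)⁻¹ * vertexFn L M β (gaussConv ℂ (softCovOf L M β μ K ψ + hubbardCovAboveCT L M β μ 0 K (klScale klE0 (n + 1)) -
              hubbardCovAboveCT L M β μ 0 K (klScale klE0 n + t * (klScale klE0 (n + 1) - klScale klE0 n))) (grassmannDerivPairing ℂ (Matrix.of fun X Y : HubbardFieldIdx L M => deriv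
              (fun Λ'' : ℝ => hubbardCovAboveCT L M β μ 0 K Λ'' X Y) (klScale klE0 n + t * (klScale klE0 (n + 1) - klScale klE0 n))) (hubbardEffectiveActionCT L M β U μ 0 K (klScale
              klE0 n + t * (klScale klE0 (n + 1) - klScale klE0 n))) (hubbardEffectiveActionCT L M β U μ 0 K (klScale klE0 n + t * (klScale klE0 (n + 1) - klScale klE0 n))))) 4
              ![(((omega0 M, k'), 0), 0), ((((omega0 M).rev, Qm - k'), 1), 0), ((((omega0 M).rev, Qm - k), 1), 1), (((omega0 M, k), 0), 1)])
      else 0)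
    (hb'def : b' = fun (t : ℝ) (p : TorusSite 2 L) => (((klScale klE0 (n + 1) - klScale klE0 n) *
        (klBubbleMass L M β μ K (fun k => deriv (fun Λ' => hubbardCutoffWeightCT L M β μ K Λ' k) (klScale klE0 n + t * (klScale klE0 (n + 1) - klScale klE0 n))) (fun k => ψ k +
                (hubbardCutoffWeightCT L M β μ K (klScale klE0 (n + 1)) k - hubbardCutoffWeightCT L M β μ K (klScale klE0 n + t * (klScale klE0 (n + 1) - klScale klE0 n)) k)) Qm p +
          klBubbleMass L M β μ K (fun k => ψ k + (hubbardCutoffWeightCT L M β μ K (klScale klE0 (n + 1)) k - hubbardCutoffWeightCT L M β μ K (klScale klE0 n + t * (klScale klE0 (n + 1)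
                  - klScale klE0 n)) k)) (fun k => deriv (fun Λ' => hubbardCutoffWeightCT L M β μ K Λ' k) (klScale klE0 n + t * (klScale klE0 (n + 1) - klScale klE0 n))) Qm p) : ℝ) :
                  ℂ))
    (V : ℝ → (Fin 4 → HubbardFieldIdx L M) → ℂ) (hV : V = fun t X => vertexFn L M β (gaussConv ℂ (softCovOf L M β μ K ψ + hubbardCovAboveCT L M β μ 0 K (klScale klE0 (n + 1)) -
            hubbardCovAboveCT L M β μ 0 K (klScale klE0 n + t * (klScale klE0 (n + 1) - klScale klE0 n))) (hubbardEffectiveActionCT L M β U μ 0 K (klScale klE0 n + t * (klScale klE0 (n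
            + 1) - klScale klE0 n)))) 4 X)
    (V6 : ℝ → (Fin 6 → HubbardFieldIdx L M) → ℂ) (hV6 : V6 = fun t X => vertexFn L M β (gaussConv ℂ (softCovOf L M β μ K ψ + hubbardCovAboveCT L M β μ 0 K (klScale klE0 (n + 1)) -
            hubbardCovAboveCT L M β μ 0 K (klScale klE0 n + t * (klScale klE0 (n + 1) - klScale klE0 n))) (hubbardEffectiveActionCT L M β U μ 0 K (klScale klE0 n + t * (klScale klE0 (n
            + 1) - klScale klE0 n)))) 6 X)
    (Sg : ℝ → FreqMomentum L M → Fin 2 → ℂ) (hSg : Sg = fun t p σ => selfEnergy L M β (gaussConv ℂ (softCovOf L M β μ K ψ + hubbardCovAboveCT L M β μ 0 K (klScale klE0 (n + 1)) -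
            hubbardCovAboveCT L M β μ 0 K (klScale klE0 n + t * (klScale klE0 (n + 1) - klScale klE0 n))) (hubbardEffectiveActionCT L M β U μ 0 K (klScale klE0 n + t * (klScale klE0 (n
            + 1) - klScale klE0 n)))) p σ)
    (Hd : ℝ → (Fin 4 → HubbardFieldIdx L M) → ℂ) (hHd : Hd = fun t X => vertexFn L M β (dblFold ℂ (grassmannLaplacian ℂ (crossCov ℂ (Matrix.of fun X Y : HubbardFieldIdx L M => deriv
            (fun Λ' : ℝ => hubbardCovAboveCT L M β μ 0 K Λ' X Y) (klScale klE0 n + t * (klScale klE0 (n + 1) - klScale klE0 n)))) ((gaussConv ℂ (crossCov ℂ (softCovOf L M β μ K ψ +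
            hubbardCovAboveCT L M β μ 0 K (klScale klE0 (n + 1)) - hubbardCovAboveCT L M β μ 0 K (klScale klE0 n + t * (klScale klE0 (n + 1) - klScale klE0 n)))) - grassmannLaplacian ℂ
            (crossCov ℂ (softCovOf L M β μ K ψ + hubbardCovAboveCT L M β μ 0 K (klScale klE0 (n + 1)) - hubbardCovAboveCT L M β μ 0 K (klScale klE0 n + t * (klScale klE0 (n + 1) -
            klScale klE0 n))))) (dblCopy ℂ 0 (gaussConv ℂ (softCovOf L M β μ K ψ + hubbardCovAboveCT L M β μ 0 K (klScale klE0 (n + 1)) - hubbardCovAboveCT L M β μ 0 K (klScale klE0 n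
            + t * (klScale klE0 (n + 1) - klScale klE0 n))) (hubbardEffectiveActionCT L M β U μ 0 K (klScale klE0 n + t * (klScale klE0 (n + 1) - klScale klE0 n)))) * dblCopy ℂ 1
            (gaussConv ℂ (softCovOf L M β μ K ψ + hubbardCovAboveCT L M β μ 0 K (klScale klE0 (n + 1)) - hubbardCovAboveCT L M β μ 0 K (klScale klE0 n + t * (klScale klE0 (n + 1) -
            klScale klE0 n))) (hubbardEffectiveActionCT L M β U μ 0 K (klScale klE0 n + t * (klScale klE0 (n + 1) - klScale klE0 n)))))))) 4 X)
    (Φ : ℝ → FreqMomentum L M → ℝ) (hΦ : Φ = fun t k => ψ k + (hubbardCutoffWeightCT L M β μ K (klScale klE0 (n + 1)) k - hubbardCutoffWeightCT L M β μ K (klScale klE0 n + t * (klScale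
            klE0 (n + 1) - klScale klE0 n)) k))
    (Wd : ℝ → FreqMomentum L M → ℝ) (hWd : Wd = fun t k => deriv (fun Λ' : ℝ => hubbardCutoffWeightCT L M β μ K Λ' k) (klScale klE0 n + t * (klScale klE0 (n + 1) - klScale klE0 n)))
    (Br : ℝ → TorusSite 2 L × MatsubaraIdx M → ℂ) (hBr : Br = fun t z => -(((((β * (L : ℝ) ^ 2 : ℝ) : ℂ)))⁻¹ * propCT L M β μ K (z.2, z.1) * propCT L M β μ K (z.2.rev, Qm - z.1)) *
      ((((klScale klE0 (n + 1) - klScale klE0 n) * (-Wd t (z.2, z.1) * Φ t (z.2.rev, Qm - z.1) - Φ t (z.2, z.1) * Wd t (z.2.rev, Qm - z.1))) : ℝ) : ℂ))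
    {t : ℝ} (ht : t ∈ Icc (0 : ℝ) 1) (x y : TorusSite 2 L) {RH RP RQ RS RL : ℝ}
    (hH : ‖Hd t ![(((omega0 M, y), 0), 0), ((((omega0 M).rev, Qm - y), 1), 0), ((((omega0 M).rev, Qm - x), 1), 1), (((omega0 M, x), 0), 1)]‖ ≤ RH)
    (hP : ‖(∑ p : FreqMomentum L M, ∑ σ : Fin 2, ∑ p' : FreqMomentum L M,
            if matsubaraInt M p'.1 + matsubaraInt M (omega0 M) = matsubaraInt M p.1 + matsubaraInt M (omega0 M) ∧ p'.2 = p.2 + x - y then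
              ((((((Φ t p) : ℝ) : ℂ) * (((β * (L : ℝ) ^ 2 : ℝ) : ℂ) * propCT L M β μ K p)) * ((((Wd t p') : ℝ) : ℂ) * (((β * (L : ℝ) ^ 2 : ℝ) : ℂ) * propCT L M β μ K p'))) + (((((Wd t
                      p) : ℝ) : ℂ) * (((β * (L : ℝ) ^ 2 : ℝ) : ℂ) * propCT L M β μ K p)) * ((((Φ t p') : ℝ) : ℂ) * (((β * (L : ℝ) ^ 2 : ℝ) : ℂ) * propCT L M β μ K p')))) *
                (V t ![((p, σ), 1), ((p', σ), 0), (((omega0 M, y), 0), 0), (((omega0 M, x), 0), 1)] *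
                  V t ![((p, σ), 0), ((p', σ), 1), ((((omega0 M).rev, Qm - y), 1), 0), ((((omega0 M).rev, Qm - x), 1), 1)])
            else 0)‖ ≤ RP)
    (hQ : ‖(∑ p : FreqMomentum L M, ∑ p' : FreqMomentum L M,
            if matsubaraInt M p'.1 + matsubaraInt M (omega0 M) + matsubaraInt M (omega0 M) + 1 = matsubaraInt M p.1 ∧ p'.2 = p.2 + Qm - x - y then
              ((((((Φ t p) : ℝ) : ℂ) * (((β * (L : ℝ) ^ 2 : ℝ) : ℂ) * propCT L M β μ K p)) * ((((Wd t p') : ℝ) : ℂ) * (((β * (L : ℝ) ^ 2 : ℝ) : ℂ) * propCT L M β μ K p'))) + (((((Wd t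
                      p) : ℝ) : ℂ) * (((β * (L : ℝ) ^ 2 : ℝ) : ℂ) * propCT L M β μ K p)) * ((((Φ t p') : ℝ) : ℂ) * (((β * (L : ℝ) ^ 2 : ℝ) : ℂ) * propCT L M β μ K p')))) *
                (V t ![((p, 0), 1), ((p', 1), 0), (((omega0 M, y), 0), 0), ((((omega0 M).rev, Qm - x), 1), 1)] *
                  V t ![((p, 0), 0), ((p', 1), 1), ((((omega0 M).rev, Qm - y), 1), 0), (((omega0 M, x), 0), 1)])
            else 0)‖ ≤ RQ)
    (hS : ‖(∑ p : FreqMomentum L M, ∑ σ : Fin 2,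
            (((((Wd t p) : ℝ) : ℂ) * (((β * (L : ℝ) ^ 2 : ℝ) : ℂ) * propCT L M β μ K p)) * ((((Φ t p) : ℝ) : ℂ) * (((β * (L : ℝ) ^ 2 : ℝ) : ℂ) * propCT L M β μ K p))) *
              (V6 t ![((p, σ), 0), ((p, σ), 1), (((omega0 M, y), 0), 0), ((((omega0 M).rev, Qm - y), 1), 0), ((((omega0 M).rev, Qm - x), 1), 1),
                (((omega0 M, x), 0), 1)] *
                Sg t p σ))‖ ≤ RS)
    (hL : ‖∑ z : TorusSite 2 L × MatsubaraIdx M, Br t z *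
          ((if z.1 ∈ klBall L μ 0 then
              V t ![(((omega0 M, z.1), 0), 0), ((((omega0 M).rev, Qm - z.1), 1), 0), ((((omega0 M).rev, Qm - x), 1), 1), (((omega0 M, x), 0), 1)] *
                V t ![(((omega0 M, y), 0), 0), ((((omega0 M).rev, Qm - y), 1), 0), ((((omega0 M).rev, Qm - z.1), 1), 1), (((omega0 M, z.1), 0), 1)]
            else 0) -
            V t ![(((z.2, z.1), 0), 0), (((z.2.rev, Qm - z.1), 1), 0), ((((omega0 M).rev, Qm - x), 1), 1), (((omega0 M, x), 0), 1)] *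
              V t ![(((omega0 M, y), 0), 0), ((((omega0 M).rev, Qm - y), 1), 0), (((z.2.rev, Qm - z.1), 1), 1), (((z.2, z.1), 0), 1)])‖ ≤ RL) :
    ‖(A' t + A t * diagonal (b' t) * A t) x y‖ ≤
      (klScale klE0 n - klScale klE0 (n + 1)) * (2⁻¹ * RH + ((β * (L : ℝ) ^ 2) ^ 3)⁻¹ * (RP + RQ + 2 * RS)) + RL := by
  have h10 : klScale klE0 (n + 1) ≤ klScale klE0 n := (klmf_klScale_succ_pos_le n).2
  have hL0 : (0 : ℝ) < (L : ℝ) := Nat.cast_pos.mpr (Nat.pos_of_ne_zero (NeZero.ne L))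
  have hβL : 0 < β * (L : ℝ) ^ 2 := by positivity
  have ha : ‖((((klScale klE0 (n + 1) - klScale klE0 n)) : ℝ) : ℂ)‖ = klScale klE0 n - klScale klE0 (n + 1) := by
    rw [Complex.norm_real, Real.norm_eq_abs, abs_of_nonpos (sub_nonpos.2 h10)]; ring
  have hb : ‖((((β * (L : ℝ) ^ 2 : ℝ) : ℂ)) ^ 3)⁻¹‖ = ((β * (L : ℝ) ^ 2) ^ 3)⁻¹ := by
    rw [norm_inv, norm_pow, Complex.norm_real, Real.norm_eq_abs, abs_of_pos hβL]
  have hR : 0 ≤ (klScale klE0 n - klScale klE0 (n + 1)) * (2⁻¹ * RH + ((β * (L : ℝ) ^ 2) ^ 3)⁻¹ * (RP + RQ + 2 * RS)) + RL := by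
    have e0 := (norm_nonneg _).trans hH; have e1 := (norm_nonneg _).trans hP; have e2 := (norm_nonneg _).trans hQ
    have e3 := (norm_nonneg _).trans hS; have e4 := (norm_nonneg _).trans hL
    have hc : 0 ≤ ((β * (L : ℝ) ^ 2) ^ 3)⁻¹ := by positivity
    have h3 : 0 ≤ ((β * (L : ℝ) ^ 2) ^ 3)⁻¹ * (RP + RQ + 2 * RS) := mul_nonneg hc (by linarith)
    have h4 : 0 ≤ (klScale klE0 n - klScale klE0 (n + 1)) * (2⁻¹ * RH + ((β * (L : ℝ) ^ 2) ^ 3)⁻¹ * (RP + RQ + 2 * RS)) :=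
      mul_nonneg (sub_nonneg.2 h10) (by linarith)
    linarith
  rw [klmd_pinnedDefect_eq_resolved L M β U μ K hβ.ne' n hψ Qm A A' b' hAdef hA'def hb'def V hV V6 hV6 Sg hSg Hd hHd Φ hΦ Wd hWd Br hBr ht x y]
  split_ifs
  · exact klmd_norm_member_le ha hb hH hP hQ hS hL
  · simpa using hR

/-! ## §2 Two members: the ξΔ door -/

set_option maxHeartbeats 1600000 in -- the instantiated identity `klmd_pinnedDefect_sub_eq`; plumbing only
/-- **`klmd_defectDiff_le_rows`** — THE ξΔ DOOR (module docstring): binders of `klmd_pinnedDefect_sub_eq` with `0 < β`, then the nine rows at `(t,x,y)`; conclusion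
in the literal shape of row 29's `ξΔ` hypothesis (matrix difference applied at `x y`). -/
theorem klmd_defectDiff_le_rows (hβ : 0 < β) (n : ℕ) {ψ₁ ψ₂ : FreqMomentum L M → ℝ}
    (hψ₁ : ∀ k : FreqMomentum L M, ψ₁ (k.1.rev, k.2) = ψ₁ k) (hψ₂ : ∀ k : FreqMomentum L M, ψ₂ (k.1.rev, k.2) = ψ₂ k) (Qm : TorusSite 2 L)
    (Wd : ℝ → FreqMomentum L M → ℝ) (hWd : Wd = fun t k => deriv (fun Λ' : ℝ => hubbardCutoffWeightCT L M β μ K Λ' k) (klScale klE0 n + t * (klScale klE0 (n + 1) - klScale klE0 n)))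
    (A₁ A₁' : ℝ → Matrix (TorusSite 2 L) (TorusSite 2 L) ℂ) (b₁' : ℝ → TorusSite 2 L → ℂ)
    (hA₁def : A₁ = fun t => Matrix.of fun k k' : TorusSite 2 L => if k ∈ klBall L μ 0 ∧ k' ∈ klBall L μ 0 then
      vertexFn L M β (gaussConv ℂ (softCovOf L M β μ K ψ₁ + hubbardCovAboveCT L M β μ 0 K (klScale klE0 (n + 1)) - hubbardCovAboveCT L M β μ 0 K (klScale klE0 n + t * (klScale klE0 (n
              + 1) - klScale klE0 n))) (hubbardEffectiveActionCT L M β U μ 0 K (klScale klE0 n + t * (klScale klE0 (n + 1) - klScale klE0 n)))) 4 ![(((omega0 M, k'), 0), 0), ((((omega0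
              M).rev, Qm - k'), 1), 0), ((((omega0 M).rev, Qm - k), 1), 1), (((omega0 M, k), 0), 1)]
      else 0)
    (hA₁'def : A₁' = fun t => Matrix.of fun k k' : TorusSite 2 L => if k ∈ klBall L μ 0 ∧ k' ∈ klBall L μ 0 then
      (klScale klE0 (n + 1) - klScale klE0 n) • -((2 : ℂ)⁻¹ * vertexFn L M β (gaussConv ℂ (softCovOf L M β μ K ψ₁ + hubbardCovAboveCT L M β μ 0 K (klScale klE0 (n + 1)) -
              hubbardCovAboveCT L M β μ 0 K (klScale klE0 n + t * (klScale klE0 (n + 1) - klScale klE0 n))) (grassmannDerivPairing ℂ (Matrix.of fun X Y : HubbardFieldIdx L M => deriv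
              (fun Λ'' : ℝ => hubbardCovAboveCT L M β μ 0 K Λ'' X Y) (klScale klE0 n + t * (klScale klE0 (n + 1) - klScale klE0 n))) (hubbardEffectiveActionCT L M β U μ 0 K (klScale
              klE0 n + t * (klScale klE0 (n + 1) - klScale klE0 n))) (hubbardEffectiveActionCT L M β U μ 0 K (klScale klE0 n + t * (klScale klE0 (n + 1) - klScale klE0 n))))) 4
              ![(((omega0 M, k'), 0), 0), ((((omega0 M).rev, Qm - k'), 1), 0), ((((omega0 M).rev, Qm - k), 1), 1), (((omega0 M, k), 0), 1)])
      else 0)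
    (hb₁'def : b₁' = fun (t : ℝ) (p : TorusSite 2 L) => (((klScale klE0 (n + 1) - klScale klE0 n) *
        (klBubbleMass L M β μ K (fun k => deriv (fun Λ' => hubbardCutoffWeightCT L M β μ K Λ' k) (klScale klE0 n + t * (klScale klE0 (n + 1) - klScale klE0 n))) (fun k => ψ₁ k +
                (hubbardCutoffWeightCT L M β μ K (klScale klE0 (n + 1)) k - hubbardCutoffWeightCT L M β μ K (klScale klE0 n + t * (klScale klE0 (n + 1) - klScale klE0 n)) k)) Qm p +
          klBubbleMass L M β μ K (fun k => ψ₁ k + (hubbardCutoffWeightCT L M β μ K (klScale klE0 (n + 1)) k - hubbardCutoffWeightCT L M β μ K (klScale klE0 n + t * (klScale klE0 (n +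
                  1) - klScale klE0 n)) k)) (fun k => deriv (fun Λ' => hubbardCutoffWeightCT L M β μ K Λ' k) (klScale klE0 n + t * (klScale klE0 (n + 1) - klScale klE0 n))) Qm p) : ℝ)
                  : ℂ))
    (V₁ : ℝ → (Fin 4 → HubbardFieldIdx L M) → ℂ) (hV₁ : V₁ = fun t X => vertexFn L M β (gaussConv ℂ (softCovOf L M β μ K ψ₁ + hubbardCovAboveCT L M β μ 0 K (klScale klE0 (n + 1)) -
            hubbardCovAboveCT L M β μ 0 K (klScale klE0 n + t * (klScale klE0 (n + 1) - klScale klE0 n))) (hubbardEffectiveActionCT L M β U μ 0 K (klScale klE0 n + t * (klScale klE0 (n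
            + 1) - klScale klE0 n)))) 4 X)
    (V6₁ : ℝ → (Fin 6 → HubbardFieldIdx L M) → ℂ) (hV6₁ : V6₁ = fun t X => vertexFn L M β (gaussConv ℂ (softCovOf L M β μ K ψ₁ + hubbardCovAboveCT L M β μ 0 K (klScale klE0 (n + 1)) -
            hubbardCovAboveCT L M β μ 0 K (klScale klE0 n + t * (klScale klE0 (n + 1) - klScale klE0 n))) (hubbardEffectiveActionCT L M β U μ 0 K (klScale klE0 n + t * (klScale klE0 (n
            + 1) - klScale klE0 n)))) 6 X)
    (Sg₁ : ℝ → FreqMomentum L M → Fin 2 → ℂ) (hSg₁ : Sg₁ = fun t p σ => selfEnergy L M β (gaussConv ℂ (softCovOf L M β μ K ψ₁ + hubbardCovAboveCT L M β μ 0 K (klScale klE0 (n + 1)) -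
            hubbardCovAboveCT L M β μ 0 K (klScale klE0 n + t * (klScale klE0 (n + 1) - klScale klE0 n))) (hubbardEffectiveActionCT L M β U μ 0 K (klScale klE0 n + t * (klScale klE0 (n
            + 1) - klScale klE0 n)))) p σ)
    (Hd₁ : ℝ → (Fin 4 → HubbardFieldIdx L M) → ℂ) (hHd₁ : Hd₁ = fun t X => vertexFn L M β (dblFold ℂ (grassmannLaplacian ℂ (crossCov ℂ (Matrix.of fun X Y : HubbardFieldIdx L M => deriv
            (fun Λ' : ℝ => hubbardCovAboveCT L M β μ 0 K Λ' X Y) (klScale klE0 n + t * (klScale klE0 (n + 1) - klScale klE0 n)))) ((gaussConv ℂ (crossCov ℂ (softCovOf L M β μ K ψ₁ +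
            hubbardCovAboveCT L M β μ 0 K (klScale klE0 (n + 1)) - hubbardCovAboveCT L M β μ 0 K (klScale klE0 n + t * (klScale klE0 (n + 1) - klScale klE0 n)))) - grassmannLaplacian ℂ
            (crossCov ℂ (softCovOf L M β μ K ψ₁ + hubbardCovAboveCT L M β μ 0 K (klScale klE0 (n + 1)) - hubbardCovAboveCT L M β μ 0 K (klScale klE0 n + t * (klScale klE0 (n + 1) -
            klScale klE0 n))))) (dblCopy ℂ 0 (gaussConv ℂ (softCovOf L M β μ K ψ₁ + hubbardCovAboveCT L M β μ 0 K (klScale klE0 (n + 1)) - hubbardCovAboveCT L M β μ 0 K (klScale klE0 n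
            + t * (klScale klE0 (n + 1) - klScale klE0 n))) (hubbardEffectiveActionCT L M β U μ 0 K (klScale klE0 n + t * (klScale klE0 (n + 1) - klScale klE0 n)))) * dblCopy ℂ 1
            (gaussConv ℂ (softCovOf L M β μ K ψ₁ + hubbardCovAboveCT L M β μ 0 K (klScale klE0 (n + 1)) - hubbardCovAboveCT L M β μ 0 K (klScale klE0 n + t * (klScale klE0 (n + 1) -
            klScale klE0 n))) (hubbardEffectiveActionCT L M β U μ 0 K (klScale klE0 n + t * (klScale klE0 (n + 1) - klScale klE0 n)))))))) 4 X)
    (Φ₁ : ℝ → FreqMomentum L M → ℝ) (hΦ₁ : Φ₁ = fun t k => ψ₁ k + (hubbardCutoffWeightCT L M β μ K (klScale klE0 (n + 1)) k - hubbardCutoffWeightCT L M β μ K (klScale klE0 n + t *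
            (klScale klE0 (n + 1) - klScale klE0 n)) k))
    (Br₁ : ℝ → TorusSite 2 L × MatsubaraIdx M → ℂ) (hBr₁ : Br₁ = fun t z => -(((((β * (L : ℝ) ^ 2 : ℝ) : ℂ)))⁻¹ * propCT L M β μ K (z.2, z.1) * propCT L M β μ K (z.2.rev, Qm - z.1)) *
      ((((klScale klE0 (n + 1) - klScale klE0 n) * (-Wd t (z.2, z.1) * Φ₁ t (z.2.rev, Qm - z.1) - Φ₁ t (z.2, z.1) * Wd t (z.2.rev, Qm - z.1))) : ℝ) : ℂ))
    (A₂ A₂' : ℝ → Matrix (TorusSite 2 L) (TorusSite 2 L) ℂ) (b₂' : ℝ → TorusSite 2 L → ℂ)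
    (hA₂def : A₂ = fun t => Matrix.of fun k k' : TorusSite 2 L => if k ∈ klBall L μ 0 ∧ k' ∈ klBall L μ 0 then
      vertexFn L M β (gaussConv ℂ (softCovOf L M β μ K ψ₂ + hubbardCovAboveCT L M β μ 0 K (klScale klE0 (n + 1)) - hubbardCovAboveCT L M β μ 0 K (klScale klE0 n + t * (klScale klE0 (n
              + 1) - klScale klE0 n))) (hubbardEffectiveActionCT L M β U μ 0 K (klScale klE0 n + t * (klScale klE0 (n + 1) - klScale klE0 n)))) 4 ![(((omega0 M, k'), 0), 0), ((((omega0
              M).rev, Qm - k'), 1), 0), ((((omega0 M).rev, Qm - k), 1), 1), (((omega0 M, k), 0), 1)]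
      else 0)
    (hA₂'def : A₂' = fun t => Matrix.of fun k k' : TorusSite 2 L => if k ∈ klBall L μ 0 ∧ k' ∈ klBall L μ 0 then
      (klScale klE0 (n + 1) - klScale klE0 n) • -((2 : ℂ)⁻¹ * vertexFn L M β (gaussConv ℂ (softCovOf L M β μ K ψ₂ + hubbardCovAboveCT L M β μ 0 K (klScale klE0 (n + 1)) -
              hubbardCovAboveCT L M β μ 0 K (klScale klE0 n + t * (klScale klE0 (n + 1) - klScale klE0 n))) (grassmannDerivPairing ℂ (Matrix.of fun X Y : HubbardFieldIdx L M => deriv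
              (fun Λ'' : ℝ => hubbardCovAboveCT L M β μ 0 K Λ'' X Y) (klScale klE0 n + t * (klScale klE0 (n + 1) - klScale klE0 n))) (hubbardEffectiveActionCT L M β U μ 0 K (klScale
              klE0 n + t * (klScale klE0 (n + 1) - klScale klE0 n))) (hubbardEffectiveActionCT L M β U μ 0 K (klScale klE0 n + t * (klScale klE0 (n + 1) - klScale klE0 n))))) 4
              ![(((omega0 M, k'), 0), 0), ((((omega0 M).rev, Qm - k'), 1), 0), ((((omega0 M).rev, Qm - k), 1), 1), (((omega0 M, k), 0), 1)])
      else 0)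
    (hb₂'def : b₂' = fun (t : ℝ) (p : TorusSite 2 L) => (((klScale klE0 (n + 1) - klScale klE0 n) *
        (klBubbleMass L M β μ K (fun k => deriv (fun Λ' => hubbardCutoffWeightCT L M β μ K Λ' k) (klScale klE0 n + t * (klScale klE0 (n + 1) - klScale klE0 n))) (fun k => ψ₂ k +
                (hubbardCutoffWeightCT L M β μ K (klScale klE0 (n + 1)) k - hubbardCutoffWeightCT L M β μ K (klScale klE0 n + t * (klScale klE0 (n + 1) - klScale klE0 n)) k)) Qm p +
          klBubbleMass L M β μ K (fun k => ψ₂ k + (hubbardCutoffWeightCT L M β μ K (klScale klE0 (n + 1)) k - hubbardCutoffWeightCT L M β μ K (klScale klE0 n + t * (klScale klE0 (n +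
                  1) - klScale klE0 n)) k)) (fun k => deriv (fun Λ' => hubbardCutoffWeightCT L M β μ K Λ' k) (klScale klE0 n + t * (klScale klE0 (n + 1) - klScale klE0 n))) Qm p) : ℝ)
                  : ℂ))
    (V₂ : ℝ → (Fin 4 → HubbardFieldIdx L M) → ℂ) (hV₂ : V₂ = fun t X => vertexFn L M β (gaussConv ℂ (softCovOf L M β μ K ψ₂ + hubbardCovAboveCT L M β μ 0 K (klScale klE0 (n + 1)) -
            hubbardCovAboveCT L M β μ 0 K (klScale klE0 n + t * (klScale klE0 (n + 1) - klScale klE0 n))) (hubbardEffectiveActionCT L M β U μ 0 K (klScale klE0 n + t * (klScale klE0 (n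
            + 1) - klScale klE0 n)))) 4 X)
    (V6₂ : ℝ → (Fin 6 → HubbardFieldIdx L M) → ℂ) (hV6₂ : V6₂ = fun t X => vertexFn L M β (gaussConv ℂ (softCovOf L M β μ K ψ₂ + hubbardCovAboveCT L M β μ 0 K (klScale klE0 (n + 1)) -
            hubbardCovAboveCT L M β μ 0 K (klScale klE0 n + t * (klScale klE0 (n + 1) - klScale klE0 n))) (hubbardEffectiveActionCT L M β U μ 0 K (klScale klE0 n + t * (klScale klE0 (n
            + 1) - klScale klE0 n)))) 6 X)
    (Sg₂ : ℝ → FreqMomentum L M → Fin 2 → ℂ) (hSg₂ : Sg₂ = fun t p σ => selfEnergy L M β (gaussConv ℂ (softCovOf L M β μ K ψ₂ + hubbardCovAboveCT L M β μ 0 K (klScale klE0 (n + 1)) -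
            hubbardCovAboveCT L M β μ 0 K (klScale klE0 n + t * (klScale klE0 (n + 1) - klScale klE0 n))) (hubbardEffectiveActionCT L M β U μ 0 K (klScale klE0 n + t * (klScale klE0 (n
            + 1) - klScale klE0 n)))) p σ)
    (Hd₂ : ℝ → (Fin 4 → HubbardFieldIdx L M) → ℂ) (hHd₂ : Hd₂ = fun t X => vertexFn L M β (dblFold ℂ (grassmannLaplacian ℂ (crossCov ℂ (Matrix.of fun X Y : HubbardFieldIdx L M => deriv
            (fun Λ' : ℝ => hubbardCovAboveCT L M β μ 0 K Λ' X Y) (klScale klE0 n + t * (klScale klE0 (n + 1) - klScale klE0 n)))) ((gaussConv ℂ (crossCov ℂ (softCovOf L M β μ K ψ₂ +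
            hubbardCovAboveCT L M β μ 0 K (klScale klE0 (n + 1)) - hubbardCovAboveCT L M β μ 0 K (klScale klE0 n + t * (klScale klE0 (n + 1) - klScale klE0 n)))) - grassmannLaplacian ℂ
            (crossCov ℂ (softCovOf L M β μ K ψ₂ + hubbardCovAboveCT L M β μ 0 K (klScale klE0 (n + 1)) - hubbardCovAboveCT L M β μ 0 K (klScale klE0 n + t * (klScale klE0 (n + 1) -
            klScale klE0 n))))) (dblCopy ℂ 0 (gaussConv ℂ (softCovOf L M β μ K ψ₂ + hubbardCovAboveCT L M β μ 0 K (klScale klE0 (n + 1)) - hubbardCovAboveCT L M β μ 0 K (klScale klE0 n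
            + t * (klScale klE0 (n + 1) - klScale klE0 n))) (hubbardEffectiveActionCT L M β U μ 0 K (klScale klE0 n + t * (klScale klE0 (n + 1) - klScale klE0 n)))) * dblCopy ℂ 1
            (gaussConv ℂ (softCovOf L M β μ K ψ₂ + hubbardCovAboveCT L M β μ 0 K (klScale klE0 (n + 1)) - hubbardCovAboveCT L M β μ 0 K (klScale klE0 n + t * (klScale klE0 (n + 1) -
            klScale klE0 n))) (hubbardEffectiveActionCT L M β U μ 0 K (klScale klE0 n + t * (klScale klE0 (n + 1) - klScale klE0 n)))))))) 4 X)
    (Φ₂ : ℝ → FreqMomentum L M → ℝ) (hΦ₂ : Φ₂ = fun t k => ψ₂ k + (hubbardCutoffWeightCT L M β μ K (klScale klE0 (n + 1)) k - hubbardCutoffWeightCT L M β μ K (klScale klE0 n + t *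
            (klScale klE0 (n + 1) - klScale klE0 n)) k))
    (Br₂ : ℝ → TorusSite 2 L × MatsubaraIdx M → ℂ) (hBr₂ : Br₂ = fun t z => -(((((β * (L : ℝ) ^ 2 : ℝ) : ℂ)))⁻¹ * propCT L M β μ K (z.2, z.1) * propCT L M β μ K (z.2.rev, Qm - z.1)) *
      ((((klScale klE0 (n + 1) - klScale klE0 n) * (-Wd t (z.2, z.1) * Φ₂ t (z.2.rev, Qm - z.1) - Φ₂ t (z.2, z.1) * Wd t (z.2.rev, Qm - z.1))) : ℝ) : ℂ))
    {t : ℝ} (ht : t ∈ Icc (0 : ℝ) 1) (x y : TorusSite 2 L)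
    {Rhd Rd₁ Rd₂ Rx₁ Rx₂ R6₁ R6₂ Rl₁ Rl₂ : ℝ}
    (hHd : ‖Hd₁ t ![(((omega0 M, y), 0), 0), ((((omega0 M).rev, Qm - y), 1), 0), ((((omega0 M).rev, Qm - x), 1), 1), (((omega0 M, x), 0), 1)] - Hd₂ t ![(((omega0 M, y), 0), 0),
            ((((omega0 M).rev, Qm - y), 1), 0), ((((omega0 M).rev, Qm - x), 1), 1), (((omega0 M, x), 0), 1)]‖ ≤ Rhd)
    (hd₁ : ‖(∑ p : FreqMomentum L M, ∑ σ : Fin 2, ∑ p' : FreqMomentum L M,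
            if matsubaraInt M p'.1 + matsubaraInt M (omega0 M) = matsubaraInt M p.1 + matsubaraInt M (omega0 M) ∧ p'.2 = p.2 + x - y then
              (((((((ψ₁ p - ψ₂ p)) : ℝ) : ℂ) * (((β * (L : ℝ) ^ 2 : ℝ) : ℂ) * propCT L M β μ K p)) * ((((Wd t p') : ℝ) : ℂ) * (((β * (L : ℝ) ^ 2 : ℝ) : ℂ) * propCT L M β μ K p'))) +
                      (((((Wd t p) : ℝ) : ℂ) * (((β * (L : ℝ) ^ 2 : ℝ) : ℂ) * propCT L M β μ K p)) * (((((ψ₁ p' - ψ₂ p')) : ℝ) : ℂ) * (((β * (L : ℝ) ^ 2 : ℝ) : ℂ) * propCT L M β μ K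
                      p')))) *
                (V₁ t ![((p, σ), 1), ((p', σ), 0), (((omega0 M, y), 0), 0), (((omega0 M, x), 0), 1)] *
                  V₁ t ![((p, σ), 0), ((p', σ), 1), ((((omega0 M).rev, Qm - y), 1), 0), ((((omega0 M).rev, Qm - x), 1), 1)])
            else 0)‖ ≤ Rd₁)
    (hd₂ : ‖(∑ p : FreqMomentum L M, ∑ σ : Fin 2, ∑ p' : FreqMomentum L M,
            if matsubaraInt M p'.1 + matsubaraInt M (omega0 M) = matsubaraInt M p.1 + matsubaraInt M (omega0 M) ∧ p'.2 = p.2 + x - y then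
              ((((((Φ₂ t p) : ℝ) : ℂ) * (((β * (L : ℝ) ^ 2 : ℝ) : ℂ) * propCT L M β μ K p)) * ((((Wd t p') : ℝ) : ℂ) * (((β * (L : ℝ) ^ 2 : ℝ) : ℂ) * propCT L M β μ K p'))) + (((((Wd t
                      p) : ℝ) : ℂ) * (((β * (L : ℝ) ^ 2 : ℝ) : ℂ) * propCT L M β μ K p)) * ((((Φ₂ t p') : ℝ) : ℂ) * (((β * (L : ℝ) ^ 2 : ℝ) : ℂ) * propCT L M β μ K p')))) *
                (V₁ t ![((p, σ), 1), ((p', σ), 0), (((omega0 M, y), 0), 0), (((omega0 M, x), 0), 1)] *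
                  V₁ t ![((p, σ), 0), ((p', σ), 1), ((((omega0 M).rev, Qm - y), 1), 0), ((((omega0 M).rev, Qm - x), 1), 1)] -
                V₂ t ![((p, σ), 1), ((p', σ), 0), (((omega0 M, y), 0), 0), (((omega0 M, x), 0), 1)] *
                  V₂ t ![((p, σ), 0), ((p', σ), 1), ((((omega0 M).rev, Qm - y), 1), 0), ((((omega0 M).rev, Qm - x), 1), 1)])
            else 0)‖ ≤ Rd₂)
    (hx₁ : ‖(∑ p : FreqMomentum L M, ∑ p' : FreqMomentum L M,
            if matsubaraInt M p'.1 + matsubaraInt M (omega0 M) + matsubaraInt M (omega0 M) + 1 = matsubaraInt M p.1 ∧ p'.2 = p.2 + Qm - x - y then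
              (((((((ψ₁ p - ψ₂ p)) : ℝ) : ℂ) * (((β * (L : ℝ) ^ 2 : ℝ) : ℂ) * propCT L M β μ K p)) * ((((Wd t p') : ℝ) : ℂ) * (((β * (L : ℝ) ^ 2 : ℝ) : ℂ) * propCT L M β μ K p'))) +
                      (((((Wd t p) : ℝ) : ℂ) * (((β * (L : ℝ) ^ 2 : ℝ) : ℂ) * propCT L M β μ K p)) * (((((ψ₁ p' - ψ₂ p')) : ℝ) : ℂ) * (((β * (L : ℝ) ^ 2 : ℝ) : ℂ) * propCT L M β μ K
                      p')))) *
                (V₁ t ![((p, 0), 1), ((p', 1), 0), (((omega0 M, y), 0), 0), ((((omega0 M).rev, Qm - x), 1), 1)] *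
                  V₁ t ![((p, 0), 0), ((p', 1), 1), ((((omega0 M).rev, Qm - y), 1), 0), (((omega0 M, x), 0), 1)])
            else 0)‖ ≤ Rx₁)
    (hx₂ : ‖(∑ p : FreqMomentum L M, ∑ p' : FreqMomentum L M,
            if matsubaraInt M p'.1 + matsubaraInt M (omega0 M) + matsubaraInt M (omega0 M) + 1 = matsubaraInt M p.1 ∧ p'.2 = p.2 + Qm - x - y then
              ((((((Φ₂ t p) : ℝ) : ℂ) * (((β * (L : ℝ) ^ 2 : ℝ) : ℂ) * propCT L M β μ K p)) * ((((Wd t p') : ℝ) : ℂ) * (((β * (L : ℝ) ^ 2 : ℝ) : ℂ) * propCT L M β μ K p'))) + (((((Wd t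
                      p) : ℝ) : ℂ) * (((β * (L : ℝ) ^ 2 : ℝ) : ℂ) * propCT L M β μ K p)) * ((((Φ₂ t p') : ℝ) : ℂ) * (((β * (L : ℝ) ^ 2 : ℝ) : ℂ) * propCT L M β μ K p')))) *
                (V₁ t ![((p, 0), 1), ((p', 1), 0), (((omega0 M, y), 0), 0), ((((omega0 M).rev, Qm - x), 1), 1)] *
                  V₁ t ![((p, 0), 0), ((p', 1), 1), ((((omega0 M).rev, Qm - y), 1), 0), (((omega0 M, x), 0), 1)] -
                V₂ t ![((p, 0), 1), ((p', 1), 0), (((omega0 M, y), 0), 0), ((((omega0 M).rev, Qm - x), 1), 1)] *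
                  V₂ t ![((p, 0), 0), ((p', 1), 1), ((((omega0 M).rev, Qm - y), 1), 0), (((omega0 M, x), 0), 1)])
            else 0)‖ ≤ Rx₂)
    (h6₁ : ‖(∑ p : FreqMomentum L M, ∑ σ : Fin 2,
            (((((Wd t p) : ℝ) : ℂ) * (((β * (L : ℝ) ^ 2 : ℝ) : ℂ) * propCT L M β μ K p)) * (((((ψ₁ p - ψ₂ p)) : ℝ) : ℂ) * (((β * (L : ℝ) ^ 2 : ℝ) : ℂ) * propCT L M β μ K p))) *
              (V6₁ t ![((p, σ), 0), ((p, σ), 1), (((omega0 M, y), 0), 0), ((((omega0 M).rev, Qm - y), 1), 0), ((((omega0 M).rev, Qm - x), 1), 1),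
                (((omega0 M, x), 0), 1)] *
                Sg₁ t p σ))‖ ≤ R6₁)
    (h6₂ : ‖(∑ p : FreqMomentum L M, ∑ σ : Fin 2,
            (((((Wd t p) : ℝ) : ℂ) * (((β * (L : ℝ) ^ 2 : ℝ) : ℂ) * propCT L M β μ K p)) * ((((Φ₂ t p) : ℝ) : ℂ) * (((β * (L : ℝ) ^ 2 : ℝ) : ℂ) * propCT L M β μ K p))) *
              (V6₁ t ![((p, σ), 0), ((p, σ), 1), (((omega0 M, y), 0), 0), ((((omega0 M).rev, Qm - y), 1), 0), ((((omega0 M).rev, Qm - x), 1), 1),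
                (((omega0 M, x), 0), 1)] *
                Sg₁ t p σ -
              V6₂ t ![((p, σ), 0), ((p, σ), 1), (((omega0 M, y), 0), 0), ((((omega0 M).rev, Qm - y), 1), 0), ((((omega0 M).rev, Qm - x), 1), 1),
                (((omega0 M, x), 0), 1)] *
                Sg₂ t p σ))‖ ≤ R6₂)
    (hl₁ : ‖∑ z : TorusSite 2 L × MatsubaraIdx M, (fun z : TorusSite 2 L × MatsubaraIdx M => -(((((β * (L : ℝ) ^ 2 : ℝ) : ℂ)))⁻¹ * propCT L M β μ K (z.2, z.1) * propCT L M β μ K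
            (z.2.rev, Qm - z.1)) * ((((klScale klE0 (n + 1) - klScale klE0 n) * (-Wd t (z.2, z.1) * (ψ₁ (z.2.rev, Qm - z.1) - ψ₂ (z.2.rev, Qm - z.1)) - (ψ₁ (z.2, z.1) - ψ₂ (z.2, z.1))
            * Wd t (z.2.rev, Qm - z.1))) : ℝ) : ℂ)) z *
          ((if z.1 ∈ klBall L μ 0 then
              V₁ t ![(((omega0 M, z.1), 0), 0), ((((omega0 M).rev, Qm - z.1), 1), 0), ((((omega0 M).rev, Qm - x), 1), 1), (((omega0 M, x), 0), 1)] *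
                V₁ t ![(((omega0 M, y), 0), 0), ((((omega0 M).rev, Qm - y), 1), 0), ((((omega0 M).rev, Qm - z.1), 1), 1), (((omega0 M, z.1), 0), 1)]
            else 0) -
            V₁ t ![(((z.2, z.1), 0), 0), (((z.2.rev, Qm - z.1), 1), 0), ((((omega0 M).rev, Qm - x), 1), 1), (((omega0 M, x), 0), 1)] *
              V₁ t ![(((omega0 M, y), 0), 0), ((((omega0 M).rev, Qm - y), 1), 0), (((z.2.rev, Qm - z.1), 1), 1), (((z.2, z.1), 0), 1)])‖ ≤ Rl₁)
    (hl₂ : ‖∑ z : TorusSite 2 L × MatsubaraIdx M, Br₂ t z *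
          (((if z.1 ∈ klBall L μ 0 then
              V₁ t ![(((omega0 M, z.1), 0), 0), ((((omega0 M).rev, Qm - z.1), 1), 0), ((((omega0 M).rev, Qm - x), 1), 1), (((omega0 M, x), 0), 1)] *
                V₁ t ![(((omega0 M, y), 0), 0), ((((omega0 M).rev, Qm - y), 1), 0), ((((omega0 M).rev, Qm - z.1), 1), 1), (((omega0 M, z.1), 0), 1)]
            else 0) -
            V₁ t ![(((z.2, z.1), 0), 0), (((z.2.rev, Qm - z.1), 1), 0), ((((omega0 M).rev, Qm - x), 1), 1), (((omega0 M, x), 0), 1)] *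
              V₁ t ![(((omega0 M, y), 0), 0), ((((omega0 M).rev, Qm - y), 1), 0), (((z.2.rev, Qm - z.1), 1), 1), (((z.2, z.1), 0), 1)]) -
            ((if z.1 ∈ klBall L μ 0 then
              V₂ t ![(((omega0 M, z.1), 0), 0), ((((omega0 M).rev, Qm - z.1), 1), 0), ((((omega0 M).rev, Qm - x), 1), 1), (((omega0 M, x), 0), 1)] *
                V₂ t ![(((omega0 M, y), 0), 0), ((((omega0 M).rev, Qm - y), 1), 0), ((((omega0 M).rev, Qm - z.1), 1), 1), (((omega0 M, z.1), 0), 1)]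
            else 0) -
            V₂ t ![(((z.2, z.1), 0), 0), (((z.2.rev, Qm - z.1), 1), 0), ((((omega0 M).rev, Qm - x), 1), 1), (((omega0 M, x), 0), 1)] *
              V₂ t ![(((omega0 M, y), 0), 0), ((((omega0 M).rev, Qm - y), 1), 0), (((z.2.rev, Qm - z.1), 1), 1), (((z.2, z.1), 0), 1)]))‖ ≤ Rl₂) :
    ‖((A₁' t + A₁ t * diagonal (b₁' t) * A₁ t) - (A₂' t + A₂ t * diagonal (b₂' t) * A₂ t)) x y‖ ≤
      (klScale klE0 n - klScale klE0 (n + 1)) * (2⁻¹ * Rhd + ((β * (L : ℝ) ^ 2) ^ 3)⁻¹ * (Rd₁ + Rd₂ + Rx₁ + Rx₂ + 2 * (R6₁ + R6₂))) + (Rl₁ + Rl₂) := by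
  have h10 : klScale klE0 (n + 1) ≤ klScale klE0 n := (klmf_klScale_succ_pos_le n).2
  have hL : (0 : ℝ) < (L : ℝ) := Nat.cast_pos.mpr (Nat.pos_of_ne_zero (NeZero.ne L))
  have hβL : 0 < β * (L : ℝ) ^ 2 := by positivity
  have ha : ‖((((klScale klE0 (n + 1) - klScale klE0 n)) : ℝ) : ℂ)‖ = klScale klE0 n - klScale klE0 (n + 1) := by
    rw [Complex.norm_real, Real.norm_eq_abs, abs_of_nonpos (sub_nonpos.2 h10)]; ring
  have hb : ‖((((β * (L : ℝ) ^ 2 : ℝ) : ℂ)) ^ 3)⁻¹‖ = ((β * (L : ℝ) ^ 2) ^ 3)⁻¹ := by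
    rw [norm_inv, norm_pow, Complex.norm_real, Real.norm_eq_abs, abs_of_pos hβL]
  have hR : 0 ≤ (klScale klE0 n - klScale klE0 (n + 1)) * (2⁻¹ * Rhd + ((β * (L : ℝ) ^ 2) ^ 3)⁻¹ * (Rd₁ + Rd₂ + Rx₁ + Rx₂ + 2 * (R6₁ + R6₂))) +
      (Rl₁ + Rl₂) := by
    have e0 := (norm_nonneg _).trans hHd
    have e1 := (norm_nonneg _).trans hd₁; have e2 := (norm_nonneg _).trans hd₂; have e3 := (norm_nonneg _).trans hx₁
    have e4 := (norm_nonneg _).trans hx₂; have e5 := (norm_nonneg _).trans h6₁; have e6 := (norm_nonneg _).trans h6₂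
    have e7 := (norm_nonneg _).trans hl₁; have e8 := (norm_nonneg _).trans hl₂
    have hc : 0 ≤ ((β * (L : ℝ) ^ 2) ^ 3)⁻¹ := by positivity
    have h3 : 0 ≤ ((β * (L : ℝ) ^ 2) ^ 3)⁻¹ * (Rd₁ + Rd₂ + Rx₁ + Rx₂ + 2 * (R6₁ + R6₂)) := mul_nonneg hc (by linarith)
    have h4 : 0 ≤ (klScale klE0 n - klScale klE0 (n + 1)) * (2⁻¹ * Rhd + ((β * (L : ℝ) ^ 2) ^ 3)⁻¹ * (Rd₁ + Rd₂ + Rx₁ + Rx₂ + 2 * (R6₁ + R6₂))) :=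
      mul_nonneg (sub_nonneg.2 h10) (by linarith)
    linarith
  rw [Matrix.sub_apply, klmd_pinnedDefect_sub_eq L M β U μ K hβ.ne' n hψ₁ hψ₂ Qm Wd hWd A₁ A₁' b₁' hA₁def hA₁'def hb₁'def V₁ hV₁ V6₁ hV6₁ Sg₁ hSg₁ Hd₁ hHd₁
    Φ₁ hΦ₁ Br₁ hBr₁ A₂ A₂' b₂' hA₂def hA₂'def hb₂'def V₂ hV₂ V6₂ hV6₂ Sg₂ hSg₂ Hd₂ hHd₂ Φ₂ hΦ₂ Br₂ hBr₂ ht x y]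
  split_ifs
  · exact klmd_norm_classes_le ha hb hHd hd₁ hd₂ hx₁ hx₂ h6₁ h6₂ hl₁ hl₂
  · simpa using hR


end Summit.HubbardSuperconductivity.HubbardSuperconductivity.Theorems.KLRegimeSplit

end
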